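import Summits.Ventures.Crystal3D.Theorems.StickyWulffConstantPolycrystalWulffBoundClassRows

/-!
# `PolycrystalWulffBound`, line `PolyDensity`: the static LP rows for three classes (bridge, part 2)

Route `StickyWulffConstant` of the venture `Summits/Ventures/Crystal3D`, crux `PolycrystalWulffBound`
(item `stmt-Ventures-19482`), second prover lane (poly-p2, gen 4).  For a labelling `cls : Fin n → Fin 3` of
the grains of a polyhedral texture and three class bodies `KC i` (compact convex symmetric, `B̄(0,√3) ⊆ KC i ⊆
B̄(0,√5)`, `|KC i| = 32`, pair overlaps `≥ 27.8`, triple overlap `≥ 23.6`, vertex shaving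
`|K| − 8ε³ ≤ |K ∩ B̄(0,√(5−ε))|` for `K ⊆ KC i`), `threeClass_staticRows` produces the class variables
`F, Y, Acl, v` (free energies, free areas, class-pair interfaces, volumes) together with the THIRTEEN
static rows of the typed certificate `cert3_k278` (`…Cert3Assembly`): floors, the pair block `{0,1}`, the
triple block, eight shaved blocks and the isoperimetric row of class `2`, all in the literal form of its
hypotheses (`V := |⋃ G|`).  Used by `PolyDensity.threeClass_core`.
WHAT THIS IS NOT: the wall / energy / recolouring rows (crux vocabulary); F-C1 not moved.
-/

noncomputable section

namespace Summit.Ventures.Crystal3D.Theorems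

open MeasureTheory Set Metric
open scoped RealInnerProductSpace ENNReal Pointwise
open Summit.Ventures.Crystal3D.Cruxes.TextureLiminf.TexShadow
open Literature.Analysis.Convexity
open Literature.MathematicalPhysics.StatisticalMechanics (perimeter HasFinitePerimeter)

set_option maxHeartbeats 1600000 in  -- thirteen rows, one statement
/-- **The thirteen static rows of `cert3_k278` for three classes.**  See the module docstring: the
class variables are returned as witnesses with their defining equations, followed by
`V = v 0 + v 1 + v 2`, sign facts, symmetry of `Acl`, and the rows (names as in `cert3_k278`). -/
theorem threeClass_staticRows {n : ℕ} (G : Fin n → Set E3)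
    (hfin : ∀ f, HasFinitePerimeter (G f) ∧ volume (G f) < ⊤)
    (hPoly : ∀ f, ∃ (k : ℕ) (H : Fin k → Finset (E3 × ℝ)), G f = ⋃ i, polytope (H i))
    (hdisj : ∀ f g, f ≠ g → Disjoint (G f) (G g))
    (cls : Fin n → Fin 3) (KC : Fin 3 → Set E3)
    (hKc : ∀ i, IsCompact (KC i)) (hKv : ∀ i, Convex ℝ (KC i)) (hK0 : ∀ i, (0 : E3) ∈ KC i)
    (hKs : ∀ i, -KC i = KC i) (hK3 : ∀ i, closedBall (0 : E3) (Real.sqrt 3) ⊆ KC i)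
    (hK5 : ∀ i, KC i ⊆ closedBall (0 : E3) (Real.sqrt 5))
    (hvolK : ∀ i, (volume (KC i)).toReal = 32)
    (hpair : ∀ i j, (27.8 : ℝ) ≤ (volume (KC i ∩ KC j)).toReal)
    (htriple : (23.6 : ℝ) ≤ (volume (KC 0 ∩ KC 1 ∩ KC 2)).toReal)
    (hshave : ∀ i (K : Set E3), K ⊆ KC i → ∀ ε : ℝ, 0 < ε → ε ≤ 5 →
      (volume K).toReal - 8 * ε ^ 3 ≤ (volume (K ∩ closedBall (0 : E3) (Real.sqrt (5 - ε)))).toReal) :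
    ∃ (F Y : Fin 3 → ℝ) (Acl : Fin 3 → Fin 3 → ℝ) (v : Fin 3 → ℝ),
      (F = fun i => ∑ f ∈ Finset.univ.filter (fun f => cls f = i), (per (KC (cls f)) (G f) -
        ∑ g, (if f = g then 0 else (per (KC (cls f)) (G f) + per (KC (cls f)) (G g) - per (KC (cls f)) (G f ∪ G g)) / 2))) ∧
      (Y = fun i => ∑ f ∈ Finset.univ.filter (fun f => cls f = i), (per (closedBall (0 : E3) 1) (G f) -
        ∑ g, (if f = g then 0 else (per (closedBall (0 : E3) 1) (G f) + per (closedBall (0 : E3) 1) (G g) -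
          per (closedBall (0 : E3) 1) (G f ∪ G g)) / 2))) ∧
      (Acl = fun i j => ∑ f ∈ Finset.univ.filter (fun f => cls f = i), ∑ g ∈ Finset.univ.filter (fun f => cls f = j),
        (per (closedBall (0 : E3) 1) (G f) + per (closedBall (0 : E3) 1) (G g) - per (closedBall (0 : E3) 1) (G f ∪ G g)) / 2) ∧
      (v = fun i => (volume (⋃ f ∈ Finset.univ.filter (fun f => cls f = i), G f)).toReal) ∧
      (volume (⋃ f, G f)).toReal = v 0 + v 1 + v 2 ∧ (∀ i, 0 ≤ v i) ∧ (∀ i, 0 ≤ F i) ∧ (∀ i, 0 ≤ Y i) ∧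
      (∀ i j, i ≠ j → 0 ≤ Acl i j) ∧ (∀ i j, Acl i j = Acl j i) ∧
      (0 ≤ (1 : ℝ) * F 1 + ((-34641 : ℝ) / 20000) * Y 1) ∧
      (0 ≤ (1 : ℝ) * F 2 + ((-34641 : ℝ) / 20000) * Y 2) ∧
      (3 * ((139 : ℝ) / 5) ^ ((1 : ℝ) / 3) * ((1 : ℝ) * (volume (⋃ f, G f)).toReal + (0 : ℝ) * v 0 + (-1 : ℝ) * v 2) ^ ((2 : ℝ) / 3) ≤ (1 : ℝ) * F 0 + ((223607 : ℝ) / 100000) * Acl 0 2 + (1 : ℝ) * F 1 + ((223607 : ℝ) / 100000) * Acl 1 2) ∧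
      (3 * ((118 : ℝ) / 5) ^ ((1 : ℝ) / 3) * ((1 : ℝ) * (volume (⋃ f, G f)).toReal + (0 : ℝ) * v 0 + (0 : ℝ) * v 2) ^ ((2 : ℝ) / 3) ≤ (1 : ℝ) * F 0 + (1 : ℝ) * F 1 + (1 : ℝ) * F 2) ∧
      (3 * ((3467 : ℝ) / 125) ^ ((1 : ℝ) / 3) * ((1 : ℝ) * (volume (⋃ f, G f)).toReal + (0 : ℝ) * v 0 + (-1 : ℝ) * v 2) ^ ((2 : ℝ) / 3) ≤ (1 : ℝ) * F 0 + ((21909 : ℝ) / 10000) * Acl 0 2 + (1 : ℝ) * F 1 + ((21909 : ℝ) / 10000) * Acl 1 2) ∧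
      (3 * ((3467 : ℝ) / 125) ^ ((1 : ℝ) / 3) * ((0 : ℝ) * (volume (⋃ f, G f)).toReal + (1 : ℝ) * v 0 + (1 : ℝ) * v 2) ^ ((2 : ℝ) / 3) ≤ (1 : ℝ) * F 0 + ((21909 : ℝ) / 10000) * Acl 0 1 + (1 : ℝ) * F 2 + ((21909 : ℝ) / 10000) * Acl 1 2) ∧
      (3 * ((3973 : ℝ) / 125) ^ ((1 : ℝ) / 3) * ((0 : ℝ) * (volume (⋃ f, G f)).toReal + (1 : ℝ) * v 0 + (0 : ℝ) * v 2) ^ ((2 : ℝ) / 3) ≤ (1 : ℝ) * F 0 + ((43359 : ℝ) / 20000) * Acl 0 1 + ((43359 : ℝ) / 20000) * Acl 0 2) ∧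
      (3 * ((3973 : ℝ) / 125) ^ ((1 : ℝ) / 3) * ((1 : ℝ) * (volume (⋃ f, G f)).toReal + (-1 : ℝ) * v 0 + (-1 : ℝ) * v 2) ^ ((2 : ℝ) / 3) ≤ (1 : ℝ) * F 1 + ((43359 : ℝ) / 20000) * Acl 0 1 + ((43359 : ℝ) / 20000) * Acl 1 2) ∧
      (3 * ((3936 : ℝ) / 125) ^ ((1 : ℝ) / 3) * ((0 : ℝ) * (volume (⋃ f, G f)).toReal + (1 : ℝ) * v 0 + (0 : ℝ) * v 2) ^ ((2 : ℝ) / 3) ≤ (1 : ℝ) * F 0 + ((214477 : ℝ) / 100000) * Acl 0 1 + ((214477 : ℝ) / 100000) * Acl 0 2) ∧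
      (3 * ((3936 : ℝ) / 125) ^ ((1 : ℝ) / 3) * ((1 : ℝ) * (volume (⋃ f, G f)).toReal + (-1 : ℝ) * v 0 + (-1 : ℝ) * v 2) ^ ((2 : ℝ) / 3) ≤ (1 : ℝ) * F 1 + ((214477 : ℝ) / 100000) * Acl 0 1 + ((214477 : ℝ) / 100000) * Acl 1 2) ∧
      (3 * ((3936 : ℝ) / 125) ^ ((1 : ℝ) / 3) * ((0 : ℝ) * (volume (⋃ f, G f)).toReal + (0 : ℝ) * v 0 + (1 : ℝ) * v 2) ^ ((2 : ℝ) / 3) ≤ (1 : ℝ) * F 2 + ((214477 : ℝ) / 100000) * Acl 0 2 + ((214477 : ℝ) / 100000) * Acl 1 2) ∧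
      (3 * (31 : ℝ) ^ ((1 : ℝ) / 3) * ((0 : ℝ) * (volume (⋃ f, G f)).toReal + (0 : ℝ) * v 0 + (1 : ℝ) * v 2) ^ ((2 : ℝ) / 3) ≤ (1 : ℝ) * F 2 + ((212133 : ℝ) / 100000) * Acl 0 2 + ((212133 : ℝ) / 100000) * Acl 1 2) ∧
      (3 * (Real.pi * 4 / 3) ^ ((1 : ℝ) / 3) * ((0 : ℝ) * (volume (⋃ f, G f)).toReal + (0 : ℝ) * v 0 + (1 : ℝ) * v 2) ^ ((2 : ℝ) / 3) ≤ (1 : ℝ) * Y 2 + (1 : ℝ) * Acl 0 2 + (1 : ℝ) * Acl 1 2) := by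
  classical
  have hvol : ∀ f, volume (G f) < ⊤ := fun f => (hfin f).2
  have hKm : ∀ i, MeasurableSet (KC i) := fun i => (hKc i).measurableSet
  set V : ℝ := (volume (⋃ f, G f)).toReal with hVdef
  set wf : Fin n → Fin n → ℝ := fun f g => (per (Metric.closedBall (0 : E3) 1) (G f) +
    per (Metric.closedBall (0 : E3) 1) (G g) - per (Metric.closedBall (0 : E3) 1) (G f ∪ G g)) / 2 with hwf
  set Frf : Fin n → ℝ := fun f => per (KC (cls f)) (G f) - ∑ g, (if f = g then 0 else
    (per (KC (cls f)) (G f) + per (KC (cls f)) (G g) - per (KC (cls f)) (G f ∪ G g)) / 2) with hFrf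
  set Yf : Fin n → ℝ := fun f => per (Metric.closedBall (0 : E3) 1) (G f) -
    ∑ g, (if f = g then 0 else (per (Metric.closedBall (0 : E3) 1) (G f) +
      per (Metric.closedBall (0 : E3) 1) (G g) - per (Metric.closedBall (0 : E3) 1) (G f ∪ G g)) / 2) with hYf
  set C : Fin 3 → Finset (Fin n) := fun i => Finset.univ.filter (fun f => cls f = i) with hCdef
  set F : Fin 3 → ℝ := fun i => ∑ f ∈ C i, Frf f with hF
  set Y : Fin 3 → ℝ := fun i => ∑ f ∈ C i, Yf f with hY
  set Acl : Fin 3 → Fin 3 → ℝ := fun i j => ∑ f ∈ C i, ∑ g ∈ C j, wf f g with hAcl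
  set v : Fin 3 → ℝ := fun i => (volume (⋃ f ∈ C i, G f)).toReal with hv
  -- basic facts
  have hwf_symm : ∀ f g, wf f g = wf g f := by intro f g; simp only [hwf, Set.union_comm]; ring_nf
  have hwf_nn : ∀ f g, f ≠ g → 0 ≤ wf f g := fun f g hfg =>
    div_nonneg (iota_nonneg_of_poly G hPoly hvol hdisj (isCompact_closedBall (0 : E3) 1)
      (convex_closedBall 0 1) (Metric.mem_closedBall_self zero_le_one) hfg) zero_le_two
  have hAcl_symm : ∀ i j, Acl i j = Acl j i := by
    intro i j; simp only [hAcl]; rw [Finset.sum_comm]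
    exact Finset.sum_congr rfl fun g _ => Finset.sum_congr rfl fun f _ => hwf_symm f g
  have hAcl_nn : ∀ i j, i ≠ j → 0 ≤ Acl i j := by
    intro i j hij
    refine Finset.sum_nonneg fun f hf => Finset.sum_nonneg fun g hg => hwf_nn f g ?_
    intro h; subst h
    exact hij ((Finset.mem_filter.1 hf).2.symm.trans (Finset.mem_filter.1 hg).2)
  have hY_nn : ∀ i, 0 ≤ Y i := fun i => Finset.sum_nonneg fun f _ => freeArea_nonneg G hPoly hvol hdisj f
  have hv_nn : ∀ i, 0 ≤ v i := fun i => ENNReal.toReal_nonneg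
  obtain ⟨-, -, -, hVsum⟩ := texture_union_facts G hfin hdisj
  have hV : V = v 0 + v 1 + v 2 := by
    have h := classVolume_sum G hfin hdisj cls (Finset.univ : Finset (Fin 3))
    have hall : Finset.univ.filter (fun f => cls f ∈ (Finset.univ : Finset (Fin 3))) = Finset.univ := by
      ext f; simp
    rw [hall] at h
    rw [hVdef]
    have hU : (⋃ f ∈ (Finset.univ : Finset (Fin n)), G f) = ⋃ f, G f := by ext x; simp
    rw [← hU, h, Fin.sum_univ_three]
  -- class volumes over sets of classes
  have hvS : ∀ S : Finset (Fin 3), (volume (⋃ f ∈ Finset.univ.filter (fun f => cls f ∈ S), G f)).toReal =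
      ∑ i ∈ S, v i := fun S => classVolume_sum G hfin hdisj cls S
  -- free energies: F i ≥ 0 via the floor
  have hfloor : ∀ i, Real.sqrt 3 * Y i ≤ F i := fun i =>
    classFloor_row G hPoly hvol hdisj cls KC hKc hKv hK0 hKs (Real.sqrt_pos.2 (by norm_num)) le_rfl i (hK3 i)
  have hF_nn : ∀ i, 0 ≤ F i := fun i =>
    le_trans (mul_nonneg (Real.sqrt_nonneg 3) (hY_nn i)) (hfloor i)
  ---------------------------------------------------------------- ROWS
  have h17 : (1.73205 : ℝ) ≤ Real.sqrt 3 := by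
    rw [show (1.73205 : ℝ) = Real.sqrt (1.73205 ^ 2) by rw [Real.sqrt_sq (by norm_num)]]
    exact Real.sqrt_le_sqrt (by norm_num)
  have hfloor' : ∀ i, (1.73205 : ℝ) * Y i ≤ F i := fun i =>
    le_trans (mul_le_mul_of_nonneg_right h17 (hY_nn i)) (hfloor i)
  have h_floor1 : 0 ≤ (1 : ℝ) * F 1 + ((-34641 : ℝ) / 20000) * Y 1 := by
    have := hfloor' 1; norm_num at this ⊢; linarith
  have h_floor2 : 0 ≤ (1 : ℝ) * F 2 + ((-34641 : ℝ) / 20000) * Y 2 := by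
    have := hfloor' 2; norm_num at this ⊢; linarith
  -- generic block row instantiation
  have hsq5 : Real.sqrt 5 ≤ 2.23607 := by
    rw [show (2.23607 : ℝ) = Real.sqrt (2.23607 ^ 2) by rw [Real.sqrt_sq (by norm_num)]]
    exact Real.sqrt_le_sqrt (by norm_num)
  have hsqrt_le : ∀ (x q : ℝ), 0 ≤ q → x ≤ q ^ 2 → Real.sqrt x ≤ q := fun x q hq h =>
    (Real.sqrt_le_sqrt h).trans (by rw [Real.sqrt_sq hq])
  have hblk : ∀ (S : Finset (Fin 3)) (KB : Set E3), IsCompact KB → Convex ℝ KB → (0 : E3) ∈ KB → -KB = KB →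
      ∀ (ρ ρq Kq : ℝ), 0 < ρ → ρ ≤ ρq → KB ⊆ Metric.closedBall (0 : E3) ρ → 0 ≤ Kq → Kq ≤ (volume KB).toReal →
      (∀ i ∈ S, KB ⊆ KC i) →
      3 * Kq ^ ((1 : ℝ) / 3) * (∑ i ∈ S, v i) ^ ((2 : ℝ) / 3) ≤
        (∑ i ∈ S, F i) + ρq * ∑ i ∈ S, ∑ j ∈ Finset.univ \ S, Acl i j := by
    intro S KB hBc hBv hB0 hBs ρ ρq Kq hρ hρq hBR hKq0 hKq hsub
    have h := classBlock_row G hfin hPoly hdisj cls KC hKc hKv hK0 hKs S KB hBc hBv hB0 hBs hρ hρq hBR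
      hKq0 hKq hsub
    rw [hvS S] at h
    exact h
  -- bodies for the rows
  have hBall : ∀ r : ℝ, IsCompact (Metric.closedBall (0 : E3) r) ∧ Convex ℝ (Metric.closedBall (0 : E3) r) ∧
      -Metric.closedBall (0 : E3) r = Metric.closedBall 0 r := fun r =>
    ⟨isCompact_closedBall 0 r, convex_closedBall 0 r, by rw [neg_closedBall, neg_zero]⟩
  have hinter2 : ∀ i j, IsCompact (KC i ∩ KC j) ∧ Convex ℝ (KC i ∩ KC j) ∧ (0 : E3) ∈ KC i ∩ KC j ∧
      -(KC i ∩ KC j) = KC i ∩ KC j := fun i j =>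
    ⟨(hKc i).inter (hKc j), (hKv i).inter (hKv j), ⟨hK0 i, hK0 j⟩, by rw [Set.inter_neg, hKs, hKs]⟩
  have hshv : ∀ (K : Set E3) (ε : ℝ), IsCompact K → Convex ℝ K → (0 : E3) ∈ K → -K = K → 0 < ε → ε < 5 →
      IsCompact (K ∩ Metric.closedBall (0 : E3) (Real.sqrt (5 - ε))) ∧
      Convex ℝ (K ∩ Metric.closedBall (0 : E3) (Real.sqrt (5 - ε))) ∧
      (0 : E3) ∈ K ∩ Metric.closedBall (0 : E3) (Real.sqrt (5 - ε)) ∧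
      -(K ∩ Metric.closedBall (0 : E3) (Real.sqrt (5 - ε))) = K ∩ Metric.closedBall (0 : E3) (Real.sqrt (5 - ε)) ∧
      K ∩ Metric.closedBall (0 : E3) (Real.sqrt (5 - ε)) ⊆ Metric.closedBall (0 : E3) (Real.sqrt (5 - ε)) ∧
      0 < Real.sqrt (5 - ε) := by
    intro K ε hKc' hKv' hK0' hKs' hε hε5
    refine ⟨hKc'.inter (hBall _).1, hKv'.inter (hBall _).2.1, ⟨hK0', Metric.mem_closedBall_self
      (Real.sqrt_nonneg _)⟩, by rw [Set.inter_neg, hKs', (hBall _).2.2], Set.inter_subset_right,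
      Real.sqrt_pos.2 (by linarith)⟩
  -- sums over class sets
  have hS01 : ∀ (φ : Fin 3 → ℝ), (∑ i ∈ ({0, 1} : Finset (Fin 3)), φ i) = φ 0 + φ 1 := fun φ =>
    Finset.sum_pair (by decide)
  have hS02 : ∀ (φ : Fin 3 → ℝ), (∑ i ∈ ({0, 2} : Finset (Fin 3)), φ i) = φ 0 + φ 2 := fun φ =>
    Finset.sum_pair (by decide)
  have hD01 : (Finset.univ : Finset (Fin 3)) \ {0, 1} = {2} := by decide
  have hD02 : (Finset.univ : Finset (Fin 3)) \ {0, 2} = {1} := by decide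
  have hD0 : (Finset.univ : Finset (Fin 3)) \ {0} = {1, 2} := by decide
  have hD1 : (Finset.univ : Finset (Fin 3)) \ {1} = {0, 2} := by decide
  have hD2 : (Finset.univ : Finset (Fin 3)) \ {2} = {0, 1} := by decide
  have hcuniv : (Finset.univ : Finset (Fin 3)) \ Finset.univ = ∅ := Finset.sdiff_self _
  have hS12 : ∀ (φ : Fin 3 → ℝ), (∑ i ∈ ({1, 2} : Finset (Fin 3)), φ i) = φ 1 + φ 2 := fun φ =>
    Finset.sum_pair (by decide)
  -- row block(0,1): body KC0 ∩ KC1, Kq = 27.8, ρ = √5 ≤ 2.23607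
  have h_block_0__1_ : 3 * ((139 : ℝ) / 5) ^ ((1 : ℝ) / 3) * ((1 : ℝ) * V + (0 : ℝ) * v 0 + (-1 : ℝ) * v 2) ^ ((2 : ℝ) / 3) ≤ (1 : ℝ) * F 0 + ((223607 : ℝ) / 100000) * Acl 0 2 + (1 : ℝ) * F 1 + ((223607 : ℝ) / 100000) * Acl 1 2 := by
    obtain ⟨c1, c2, c3, c4⟩ := hinter2 0 1
    have h := hblk {0, 1} (KC 0 ∩ KC 1) c1 c2 c3 c4 (Real.sqrt 5) 2.23607 ((139 : ℝ) / 5)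
      (Real.sqrt_pos.2 (by norm_num : (0:ℝ) < 5)) hsq5
      (Set.inter_subset_left.trans (hK5 0)) (by norm_num) (by have := hpair 0 1; norm_num at this ⊢; exact this)
      (by intro i hi; simp only [Finset.mem_insert, Finset.mem_singleton] at hi
          rcases hi with rfl | rfl; exacts [Set.inter_subset_left, Set.inter_subset_right])
    rw [hD01] at h
    simp only [hS01, Finset.sum_singleton] at h
    have e : (1 : ℝ) * V + (0 : ℝ) * v 0 + (-1 : ℝ) * v 2 = v 0 + v 1 := by rw [hV]; ring
    rw [e]; norm_num at h ⊢; linarith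
  -- row block(0,1,2): triple body
  have h_block_0__1__2_ : 3 * ((118 : ℝ) / 5) ^ ((1 : ℝ) / 3) * ((1 : ℝ) * V + (0 : ℝ) * v 0 + (0 : ℝ) * v 2) ^ ((2 : ℝ) / 3) ≤ (1 : ℝ) * F 0 + (1 : ℝ) * F 1 + (1 : ℝ) * F 2 := by
    have c1 : IsCompact (KC 0 ∩ KC 1 ∩ KC 2) := ((hKc 0).inter (hKc 1)).inter (hKc 2)
    have c2 : Convex ℝ (KC 0 ∩ KC 1 ∩ KC 2) := ((hKv 0).inter (hKv 1)).inter (hKv 2)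
    have c3 : (0 : E3) ∈ KC 0 ∩ KC 1 ∩ KC 2 := ⟨⟨hK0 0, hK0 1⟩, hK0 2⟩
    have c4 : -(KC 0 ∩ KC 1 ∩ KC 2) = KC 0 ∩ KC 1 ∩ KC 2 := by rw [Set.inter_neg, Set.inter_neg, hKs, hKs, hKs]
    have h := hblk Finset.univ (KC 0 ∩ KC 1 ∩ KC 2) c1 c2 c3 c4 (Real.sqrt 5) (Real.sqrt 5) ((118 : ℝ) / 5)
      (Real.sqrt_pos.2 (by norm_num : (0:ℝ) < 5))
      le_rfl ((Set.inter_subset_left.trans Set.inter_subset_left).trans (hK5 0)) (by norm_num)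
      (by have := htriple; norm_num at this ⊢; exact this)
      (by intro i _; fin_cases i
          · exact Set.inter_subset_left.trans Set.inter_subset_left
          · exact Set.inter_subset_left.trans Set.inter_subset_right
          · exact Set.inter_subset_right)
    rw [hcuniv, Fin.sum_univ_three, Fin.sum_univ_three] at h
    simp only [Finset.sum_empty] at h
    have e : (1 : ℝ) * V + (0 : ℝ) * v 0 + (0 : ℝ) * v 2 = v 0 + v 1 + v 2 := by rw [hV]; ring
    rw [e]; norm_num at h ⊢; linarith
  -- shaved rows
  have hshv_pair : ∀ (i j : Fin 3) (ε ρq Kq : ℝ), 0 < ε → ε < 5 → Real.sqrt (5 - ε) ≤ ρq →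
      Kq + 8 * ε ^ 3 ≤ 27.8 → 0 ≤ Kq →
      3 * Kq ^ ((1 : ℝ) / 3) * (∑ k ∈ ({i, j} : Finset (Fin 3)), v k) ^ ((2 : ℝ) / 3) ≤
        (∑ k ∈ ({i, j} : Finset (Fin 3)), F k) + ρq * ∑ k ∈ ({i, j} : Finset (Fin 3)), ∑ l ∈ Finset.univ \ {i, j}, Acl k l := by
    intro i j ε ρq Kq hε hε5 hρq hKq hKq0
    obtain ⟨c1, c2, c3, c4⟩ := hinter2 i j
    obtain ⟨d1, d2, d3, d4, d5, d6⟩ := hshv (KC i ∩ KC j) ε c1 c2 c3 c4 hε hε5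
    refine hblk {i, j} _ d1 d2 d3 d4 _ ρq Kq d6 hρq d5 hKq0 ?_ ?_
    · have hs := hshave i (KC i ∩ KC j) Set.inter_subset_left ε hε hε5.le
      have hp := hpair i j
      norm_num at hp; linarith
    · intro k hk; simp only [Finset.mem_insert, Finset.mem_singleton] at hk
      rcases hk with rfl | rfl
      · exact Set.inter_subset_left.trans Set.inter_subset_left
      · exact Set.inter_subset_left.trans Set.inter_subset_right
  have hshv_single : ∀ (i : Fin 3) (ε ρq Kq : ℝ), 0 < ε → ε < 5 → Real.sqrt (5 - ε) ≤ ρq →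
      Kq + 8 * ε ^ 3 ≤ 32 → 0 ≤ Kq →
      3 * Kq ^ ((1 : ℝ) / 3) * (v i) ^ ((2 : ℝ) / 3) ≤ F i + ρq * ∑ l ∈ Finset.univ \ {i}, Acl i l := by
    intro i ε ρq Kq hε hε5 hρq hKq hKq0
    obtain ⟨d1, d2, d3, d4, d5, d6⟩ := hshv (KC i) ε (hKc i) (hKv i) (hK0 i) (hKs i) hε hε5
    have h := hblk {i} _ d1 d2 d3 d4 _ ρq Kq d6 hρq d5 hKq0 ?_ ?_
    · rw [Finset.sum_singleton, Finset.sum_singleton, Finset.sum_singleton] at h; exact h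
    · have hs := hshave i (KC i) subset_rfl ε hε hε5.le
      rw [hvolK i] at hs; linarith
    · intro k hk; rw [Finset.mem_singleton] at hk; subst hk; exact Set.inter_subset_left
  have hr02 : Real.sqrt (5 - 0.2) ≤ 2.1909 := hsqrt_le _ _ (by norm_num) (by norm_num)
  have hr03 : Real.sqrt (5 - 0.3) ≤ 2.16795 := hsqrt_le _ _ (by norm_num) (by norm_num)
  have hr04 : Real.sqrt (5 - 0.4) ≤ 2.14477 := hsqrt_le _ _ (by norm_num) (by norm_num)
  have hr05 : Real.sqrt (5 - 0.5) ≤ 2.12133 := hsqrt_le _ _ (by norm_num) (by norm_num)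
  have h_shv0_2_0__1_ : 3 * ((3467 : ℝ) / 125) ^ ((1 : ℝ) / 3) * ((1 : ℝ) * V + (0 : ℝ) * v 0 + (-1 : ℝ) * v 2) ^ ((2 : ℝ) / 3) ≤ (1 : ℝ) * F 0 + ((21909 : ℝ) / 10000) * Acl 0 2 + (1 : ℝ) * F 1 + ((21909 : ℝ) / 10000) * Acl 1 2 := by
    have h := hshv_pair 0 1 0.2 2.1909 (3467 / 125) (by norm_num) (by norm_num) hr02 (by norm_num) (by norm_num)
    rw [hD01] at h
    simp only [hS01, Finset.sum_singleton] at h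
    have e : (1 : ℝ) * V + (0 : ℝ) * v 0 + (-1 : ℝ) * v 2 = v 0 + v 1 := by rw [hV]; ring
    rw [e]; norm_num at h ⊢; linarith
  have h_shv0_2_0__2_ : 3 * ((3467 : ℝ) / 125) ^ ((1 : ℝ) / 3) * ((0 : ℝ) * V + (1 : ℝ) * v 0 + (1 : ℝ) * v 2) ^ ((2 : ℝ) / 3) ≤ (1 : ℝ) * F 0 + ((21909 : ℝ) / 10000) * Acl 0 1 + (1 : ℝ) * F 2 + ((21909 : ℝ) / 10000) * Acl 1 2 := by
    have h := hshv_pair 0 2 0.2 2.1909 (3467 / 125) (by norm_num) (by norm_num) hr02 (by norm_num) (by norm_num)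
    rw [hD02] at h
    simp only [hS02, Finset.sum_singleton] at h
    rw [hAcl_symm 2 1] at h
    have e : (0 : ℝ) * V + (1 : ℝ) * v 0 + (1 : ℝ) * v 2 = v 0 + v 2 := by ring
    rw [e]; norm_num at h ⊢; linarith
  have h_shv0_3_0__ : 3 * ((3973 : ℝ) / 125) ^ ((1 : ℝ) / 3) * ((0 : ℝ) * V + (1 : ℝ) * v 0 + (0 : ℝ) * v 2) ^ ((2 : ℝ) / 3) ≤ (1 : ℝ) * F 0 + ((43359 : ℝ) / 20000) * Acl 0 1 + ((43359 : ℝ) / 20000) * Acl 0 2 := by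
    have h := hshv_single 0 0.3 2.16795 (3973 / 125) (by norm_num) (by norm_num) hr03 (by norm_num) (by norm_num)
    rw [hD0, hS12] at h
    have e : (0 : ℝ) * V + (1 : ℝ) * v 0 + (0 : ℝ) * v 2 = v 0 := by ring
    rw [e]; norm_num at h ⊢; linarith
  have h_shv0_3_1__ : 3 * ((3973 : ℝ) / 125) ^ ((1 : ℝ) / 3) * ((1 : ℝ) * V + (-1 : ℝ) * v 0 + (-1 : ℝ) * v 2) ^ ((2 : ℝ) / 3) ≤ (1 : ℝ) * F 1 + ((43359 : ℝ) / 20000) * Acl 0 1 + ((43359 : ℝ) / 20000) * Acl 1 2 := by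
    have h := hshv_single 1 0.3 2.16795 (3973 / 125) (by norm_num) (by norm_num) hr03 (by norm_num) (by norm_num)
    rw [hD1, hS02, hAcl_symm 1 0] at h
    have e : (1 : ℝ) * V + (-1 : ℝ) * v 0 + (-1 : ℝ) * v 2 = v 1 := by rw [hV]; ring
    rw [e]; norm_num at h ⊢; linarith
  have h_shv0_4_0__ : 3 * ((3936 : ℝ) / 125) ^ ((1 : ℝ) / 3) * ((0 : ℝ) * V + (1 : ℝ) * v 0 + (0 : ℝ) * v 2) ^ ((2 : ℝ) / 3) ≤ (1 : ℝ) * F 0 + ((214477 : ℝ) / 100000) * Acl 0 1 + ((214477 : ℝ) / 100000) * Acl 0 2 := by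
    have h := hshv_single 0 0.4 2.14477 (3936 / 125) (by norm_num) (by norm_num) hr04 (by norm_num) (by norm_num)
    rw [hD0, hS12] at h
    have e : (0 : ℝ) * V + (1 : ℝ) * v 0 + (0 : ℝ) * v 2 = v 0 := by ring
    rw [e]; norm_num at h ⊢; linarith
  have h_shv0_4_1__ : 3 * ((3936 : ℝ) / 125) ^ ((1 : ℝ) / 3) * ((1 : ℝ) * V + (-1 : ℝ) * v 0 + (-1 : ℝ) * v 2) ^ ((2 : ℝ) / 3) ≤ (1 : ℝ) * F 1 + ((214477 : ℝ) / 100000) * Acl 0 1 + ((214477 : ℝ) / 100000) * Acl 1 2 := by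
    have h := hshv_single 1 0.4 2.14477 (3936 / 125) (by norm_num) (by norm_num) hr04 (by norm_num) (by norm_num)
    rw [hD1, hS02, hAcl_symm 1 0] at h
    have e : (1 : ℝ) * V + (-1 : ℝ) * v 0 + (-1 : ℝ) * v 2 = v 1 := by rw [hV]; ring
    rw [e]; norm_num at h ⊢; linarith
  have h_shv0_4_2__ : 3 * ((3936 : ℝ) / 125) ^ ((1 : ℝ) / 3) * ((0 : ℝ) * V + (0 : ℝ) * v 0 + (1 : ℝ) * v 2) ^ ((2 : ℝ) / 3) ≤ (1 : ℝ) * F 2 + ((214477 : ℝ) / 100000) * Acl 0 2 + ((214477 : ℝ) / 100000) * Acl 1 2 := by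
    have h := hshv_single 2 0.4 2.14477 (3936 / 125) (by norm_num) (by norm_num) hr04 (by norm_num) (by norm_num)
    rw [hD2, hS01, hAcl_symm 2 0, hAcl_symm 2 1] at h
    have e : (0 : ℝ) * V + (0 : ℝ) * v 0 + (1 : ℝ) * v 2 = v 2 := by ring
    rw [e]; norm_num at h ⊢; linarith
  have h_shv0_5_2__ : 3 * (31 : ℝ) ^ ((1 : ℝ) / 3) * ((0 : ℝ) * V + (0 : ℝ) * v 0 + (1 : ℝ) * v 2) ^ ((2 : ℝ) / 3) ≤ (1 : ℝ) * F 2 + ((212133 : ℝ) / 100000) * Acl 0 2 + ((212133 : ℝ) / 100000) * Acl 1 2 := by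
    have hr05' : Real.sqrt (5 - 0.5) ≤ (212133 : ℝ) / 100000 := hr05.trans (by norm_num)
    have e1 : (0 : ℝ) < 0.5 := by norm_num
    have e2 : (0.5 : ℝ) < 5 := by norm_num
    have e3 : (31 : ℝ) + 8 * (0.5 : ℝ) ^ 3 ≤ 32 := by norm_num
    have e4 : (0 : ℝ) ≤ 31 := by norm_num
    have h := hshv_single 2 (0.5 : ℝ) ((212133 : ℝ) / 100000) (31 : ℝ) e1 e2 hr05' e3 e4
    rw [hD2, hS01, hAcl_symm 2 0, hAcl_symm 2 1] at h
    have e : (0 : ℝ) * V + (0 : ℝ) * v 0 + (1 : ℝ) * v 2 = v 2 := by ring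
    rw [e]; linarith only [h]
  -- iso row for class 2
  have h_iso_2__ : 3 * (Real.pi * 4 / 3) ^ ((1 : ℝ) / 3) * ((0 : ℝ) * V + (0 : ℝ) * v 0 + (1 : ℝ) * v 2) ^ ((2 : ℝ) / 3) ≤ (1 : ℝ) * Y 2 + (1 : ℝ) * Acl 0 2 + (1 : ℝ) * Acl 1 2 := by
    have h : 3 * (Real.pi * 4 / 3) ^ ((1 : ℝ) / 3) * v 2 ^ ((2 : ℝ) / 3) ≤ Y 2 + ∑ j ∈ Finset.univ \ {2}, Acl 2 j :=
      classIso_row G hfin hPoly hdisj cls 2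
    rw [hD2, hS01, hAcl_symm 2 0, hAcl_symm 2 1] at h
    have e : (0 : ℝ) * V + (0 : ℝ) * v 0 + (1 : ℝ) * v 2 = v 2 := by ring
    rw [e]; linarith
  exact ⟨F, Y, Acl, v, rfl, rfl, rfl, rfl, hV, hv_nn, hF_nn, hY_nn, hAcl_nn, hAcl_symm, h_floor1, h_floor2,
    h_block_0__1_, h_block_0__1__2_, h_shv0_2_0__1_, h_shv0_2_0__2_, h_shv0_3_0__, h_shv0_3_1__, h_shv0_4_0__,
    h_shv0_4_1__, h_shv0_4_2__, h_shv0_5_2__, h_iso_2__⟩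

end Summit.Ventures.Crystal3D.Theorems
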